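import Literature.Probability.Percolation.CLE6SubseqLimit
import Literature.Probability.Percolation.CLE6RerootSaturated
import Literature.Probability.RandomPlanarGeometry.SeparatedTraces
import Literature.Probability.Percolation.CircuitTriples
import Literature.Probability.Percolation.MacroscopicInterfaceLoop
import Literature.Probability.Percolation.TriLatticeRounding
import Mathlib.Analysis.SpecificLimits.Basic
import HarnessLib

/-!
# Scaling limits of the percolation loop collections have infinitely many non-trivial loops

Topic `Literature/Probability/Percolation`, companion to `CLE6.lean` (proofs only, no new named
facts, no new definitions). The unrooted Camia–Newman statement `exists_isCNLFamily_tendsto`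
requires of the limit law the field `IsCNLFamily.ae_infinite_traces` (F. Camia, C. M. Newman,
Comm. Math. Phys. 268 (2006), Thm 2 (ii): almost surely every deterministic point is surrounded by
infinitely many loops; here: almost surely there are infinitely many distinct non-trivial
traces). This file proves that property for **every subsequential limit** `P'` of the laws of
`triLoopCollection D δ`, by the argument of the proof of Thm 2 (ii):

* `hasSeparatedTraces_triLoopCollection_of_goodScales` (deterministic, every `ω`) — fix a disc
  `B̄(x₀, r₀) ⊆ D`; for `k` blocks of `m` geometric scales `R_j = (r/δ) 1024^j`
  (`r = r₀ / (256 · 1024^{km})`), if around the lattice point `c` nearest to `x₀/δ` every block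
  contains a scale with a circuit triple (`goodScales`, `CircuitTriples.lean`), then the `k`
  macroscopic interface loops given by `exists_macroscopic_isSiteInterfaceLoop`
  (`MacroscopicInterfaceLoop.lean`) are members of the loop collection with traces of diameter
  `≥ r/2`, pairwise at Hausdorff distance `≥ r/2`: the collection has `k` `(r/2)`-separated traces
  (`LoopSpace.HasSeparatedTraces`, `SeparatedTraces.lean`);
* probability: `P_{1/2}(goodScales) ≥ 1 - k (1 - c₀³)^m` (`le_real_goodScales`), uniformly in
  `δ ≤ r/250`;
* limit (`ae_exists_hasSeparatedTraces_of_tendsto`, `ae_infinite_traces_of_tendsto`): by the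
  closed-set portmanteau inequality for subsequential limits (`le_measure_of_isClosed_of_tendsto`,
  `CLE6SubseqLimit.lean`) applied to the closure of the event, which lies in the event at half
  the level (`LoopSpace.closure_setOf_hasSeparatedTraces_subset`), every subsequential limit law
  gives probability `≥ 1 - k (1 - c₀³)^m` to "`k` separated traces", for every `m`; letting
  `m → ∞` and then intersecting over `k`, almost surely there are separated families of every
  size, hence infinitely many non-trivial traces
  (`LoopSpace.infinite_traces_of_forall_hasSeparatedTraces`);
* `exists_isCNLFamily_tendsto_of_tendstoLaw''` — the resulting reduction of
  `exists_isCNLFamily_tendsto`: only local finiteness of traces and conformal invariance remain.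

## References

* F. Camia, C. M. Newman, Comm. Math. Phys. 268 (2006), Thm 2 (ii) and its proof [CamiaNewman2006].
* F. Camia, C. M. Newman, MSRI Publ. 55 (2008), Thms 2–3 [CamiaNewman2008].
* B. Bollobás, O. Riordan, *Percolation* (2006), Ch. 7, Lemma 4 [BollobasRiordan2006].
* P. Billingsley, *Convergence of probability measures*, 2nd ed. (1999), Thm 2.1 [Billingsley1999].
-/

noncomputable section

open Set Filter Metric MeasureTheory
open scoped ENNReal NNReal Topology

namespace Literature.Probability.Percolation

open RandomPlanarGeometry LatticeModels

/-! ### One scale: a macroscopic member of the loop collection -/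

section OneScale

variable (D : JordanDomain)

/-- **A circuit triple inside the domain produces a macroscopic member of the loop collection.**
If `ω` has a circuit triple around `c` at scale `R ≥ 1` (`circuitTriple`, open circuit in
`(4R, 8R)`, closed ones in `(16R, 32R)`, `(64R, 128R)`) and the sites of the inner annulus belong
to the mesh of `D` at mesh `δ`, then some member of `triLoopCollection D δ ω` has its trace in
the disc `B(δc, δ(128R + 2))` and two points of its trace at distance `≥ δ(R - 1)`
(`exists_macroscopic_isSiteInterfaceLoop` applied to the finite restricted configuration
`ω ∩ triMeshVertices D δ`, in which the open circuit stays open and the closed ones closed).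
[cite: CamiaNewman2006, Thm 2] -/
theorem exists_mem_triLoopCollection_of_circuitTriple {δ : ℝ} (hδ : 0 < δ) {c : Site 2} {R : ℝ}
    (hR : 1 ≤ R) (hM : annulusSites c (4 * R) (8 * R) ⊆ triMeshVertices D.carrier δ)
    {ω : SiteConfig (Site 2)} (hω : ω ∈ circuitTriple c R) :
    ∃ γ ∈ triLoopCollection D δ ω,
      (∀ z ∈ CurveClass.range γ, dist z (triMeshPoint δ c) < δ * (128 * R + 2)) ∧
      ∃ z ∈ CurveClass.range γ, ∃ z' ∈ CurveClass.range γ, δ * (R - 1) ≤ dist z z' := by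
  obtain ⟨⟨⟨vO, O, hOs, hOb⟩, ⟨vC, C, hCs, hCb⟩⟩, ⟨vCC, CC, hCCs, hCCb⟩⟩ := hω
  set ω' : SiteConfig (Site 2) := ω ∩ triMeshVertices D.carrier δ with hω'
  have hfin : ω'.Finite := (triMeshVertices_finite_holds D.isBounded hδ).subset inter_subset_right
  obtain ⟨F, w, hw, hloc, z, hz, z', hz', hzz'⟩ := exists_macroscopic_isSiteInterfaceLoop hfin hR hδ
    ⟨vO, O, fun x hx ↦ ⟨⟨(hOs x hx).1, hM (hOs x hx).2⟩, (hOs x hx).2⟩, hOb⟩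
    ⟨vC, C, fun x hx ↦ ⟨fun h ↦ (hCs x hx).1 h.1, (hCs x hx).2⟩, hCb⟩
    ⟨vCC, CC, fun x hx ↦ ⟨fun h ↦ (hCCs x hx).1 h.1, (hCCs x hx).2⟩, hCCb⟩
  have hlen : 0 < w.length := by have := hw.isCycle.three_le_length; omega
  have hrange : CurveClass.range (siteLoopCurve δ w) = polyTrace δ w := by
    rw [siteLoopCurve, CurveClass.range_mk]
    exact range_toCurve_eq_polyTrace hlen
  refine ⟨siteLoopCurve δ w, siteLoopCurve_mem_triLoopCollection hw, ?_, ?_⟩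
  · rw [hrange]; exact hloc
  · rw [hrange]; exact ⟨z, hz, z', hz', hzz'⟩

end OneScale

/-! ### Metric separation of two macroscopic loops at different scales -/

/-- **Separation of scales.** If `T ⊆ B(P, ρ)` and `T'` contains two points at distance `≥ d`,
then some point of `T'` is at distance `≥ d/2 - ρ` from every point of `T`; hence for compact
nonempty `T`, `T'` the Hausdorff distance is `≥ d/2 - ρ`. [folklore] -/
theorem le_hausdorffDist_of_subset_ball_of_far {T T' : Set ℂ} (hT : IsCompact T) (hTne : T.Nonempty)
    (hT' : IsCompact T') (hT'ne : T'.Nonempty) {P : ℂ} {ρ d : ℝ} (hsub : ∀ z ∈ T, dist z P < ρ)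
    (hfar : ∃ z ∈ T', ∃ z' ∈ T', d ≤ dist z z') : d / 2 - ρ ≤ hausdorffDist T T' := by
  obtain ⟨z, hz, z', hz', hzz'⟩ := hfar
  -- one of `z`, `z'` is at distance `≥ d/2` from `P`
  obtain ⟨y, hy, hyP⟩ : ∃ y ∈ T', d / 2 ≤ dist y P := by
    by_contra h
    push Not at h
    have h1 := h z hz
    have h2 := h z' hz'
    have := dist_triangle z P z'
    rw [dist_comm P z'] at this
    linarith
  have hfin : hausdorffEDist T' T ≠ ⊤ :=
    hausdorffEDist_ne_top_of_nonempty_of_bounded hT'ne hTne hT'.isBounded hT.isBounded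
  rw [hausdorffDist_comm]
  refine le_trans ?_ (infDist_le_hausdorffDist_of_mem hy hfin)
  obtain ⟨x, hx, hxy⟩ := hT.exists_infDist_eq_dist hTne y
  rw [hxy]
  have := hsub x hx
  have := dist_triangle y x P
  linarith

/-! ### Many scales: the loop collection has many separated traces -/

section ManyScales

variable (D : JordanDomain)

/-- **On the good-scales event the loop collection has `k` separated macroscopic traces**
(deterministic, for every configuration). Let `B̄(x₀, r₀) ⊆ D`, `k, m ∈ ℕ`,
`r = r₀ / (256 · 1024^{km})`, `0 < δ ≤ r/250`, and `c` a lattice point with `δ c` within `δ` of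
`x₀`. If around `c` each of the `k` blocks of `m` scales `R_j = (r/δ) 1024^j` contains a scale
with a circuit triple (`goodScales c (r/δ) k m`), then `triLoopCollection D δ ω` has `k` members
with traces of diameter `≥ r/2` pairwise at Hausdorff distance `≥ r/2`: the macroscopic loops of
the `k` scales (`exists_mem_triLoopCollection_of_circuitTriple`) — a loop at scale `R_j` lies in
`B(δc, 130 δ R_j)`, while a loop at a larger scale `R_{j'} ≥ 1024 R_j` has diameter
`≥ δ(R_{j'} - 1)`, so the two traces are `≥ δ R_j ≥ r` apart
(`le_hausdorffDist_of_subset_ball_of_far`). [cite: CamiaNewman2006, Thm 2] -/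
theorem hasSeparatedTraces_triLoopCollection_of_goodScales {x₀ : ℂ} {r₀ : ℝ} (hr₀ : 0 < r₀)
    (hball : closedBall x₀ r₀ ⊆ D.carrier) (k m : ℕ) {δ : ℝ} (hδ : 0 < δ)
    (hδr : δ ≤ r₀ / (256 * 1024 ^ (k * m)) / 250) {c : Site 2} (hc : dist x₀ (triMeshPoint δ c) ≤ δ)
    {ω : SiteConfig (Site 2)} (hω : ω ∈ goodScales c (r₀ / (256 * 1024 ^ (k * m)) / δ) k m) :
    LoopSpace.HasSeparatedTraces k (r₀ / (256 * 1024 ^ (k * m)) / 2) (triLoopCollection D δ ω) := by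
  set N := k * m with hN
  set r : ℝ := r₀ / (256 * 1024 ^ N) with hr
  set R₀ : ℝ := r / δ with hR₀
  have hpowN : (1 : ℝ) ≤ 1024 ^ N := one_le_pow₀ (by norm_num)
  have hr0 : 0 < r := by positivity
  have hrr₀ : r * (256 * 1024 ^ N) = r₀ := by rw [hr]; field_simp
  have hR₀ge : 250 ≤ R₀ := by
    rw [hR₀, le_div_iff₀ hδ]; linarith
  have hδR₀ : δ * R₀ = r := by rw [hR₀]; field_simp
  -- the scale of block `g` and its loop
  have hblock : ∀ g : Fin k, ∃ j, (g : ℕ) * m ≤ j ∧ j < (g + 1) * m ∧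
      ω ∈ circuitTriple c (circuitScale R₀ j) := by
    intro g
    have := (mem_iInter₂.1 hω) g (Finset.mem_range.2 g.2)
    simp only [mem_iUnion, Finset.mem_Ico, exists_prop] at this
    obtain ⟨j, ⟨h1, h2⟩, h3⟩ := this
    exact ⟨j, h1, h2, h3⟩
  choose j hjlo hjhi hjT using hblock
  have hjN : ∀ g, j g < N := fun g ↦ by
    have := hjhi g
    have hg : (g : ℕ) + 1 ≤ k := g.2
    calc j g < (g + 1) * m := this
      _ ≤ k * m := Nat.mul_le_mul_right m hg
  -- scales: `R_j ≥ R₀ ≥ 250`, physical size `δ R_j = r 1024^j ≤ r 1024^N`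
  have hRj : ∀ g, R₀ ≤ circuitScale R₀ (j g) := fun g ↦ le_circuitScale (by linarith) _
  have hRj1 : ∀ g, (1 : ℝ) ≤ circuitScale R₀ (j g) := fun g ↦ by linarith [hRj g]
  have hδRj : ∀ g, δ * circuitScale R₀ (j g) ≤ r * 1024 ^ N := by
    intro g
    rw [circuitScale, ← mul_assoc, hδR₀]
    exact mul_le_mul_of_nonneg_left (pow_le_pow_right₀ (by norm_num) (hjN g).le) hr0.le
  -- the inner annulus of every scale lies in the mesh of `D`
  have hM : ∀ g, annulusSites c (4 * circuitScale R₀ (j g)) (8 * circuitScale R₀ (j g)) ⊆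
      triMeshVertices D.carrier δ := by
    intro g x hx
    rw [mem_triMeshVertices_iff]
    apply hball
    rw [mem_closedBall]
    have h1 : dist (triMeshPoint δ x) (triMeshPoint δ c) < δ * (8 * circuitScale R₀ (j g)) := by
      rw [dist_triMeshPoint_eq hδ.le]; exact mul_lt_mul_of_pos_left hx.2 hδ
    calc dist (triMeshPoint δ x) x₀ ≤ dist (triMeshPoint δ x) (triMeshPoint δ c) + dist (triMeshPoint δ c) x₀ :=
          dist_triangle _ _ _
      _ ≤ δ * (8 * circuitScale R₀ (j g)) + δ := by rw [dist_comm (triMeshPoint δ c)]; linarith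
      _ ≤ 8 * (r * 1024 ^ N) + r / 250 := by nlinarith [hδRj g]
      _ ≤ r₀ := by rw [← hrr₀]; nlinarith
  -- the loops
  choose γ hγmem hγloc hγfar using fun g ↦
    exists_mem_triLoopCollection_of_circuitTriple D hδ (hRj1 g) (hM g) (hjT g)
  refine ⟨γ, hγmem, fun g ↦ ?_, fun g g' hgg' ↦ ?_⟩
  · -- diameter
    obtain ⟨z, hz, z', hz', hzz'⟩ := hγfar g
    have hd : δ * (circuitScale R₀ (j g) - 1) ≤ diam (γ g).range :=
      hzz'.trans (dist_le_diam_of_mem (CurveClass.isCompact_range _).isBounded hz hz')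
    have : r / 2 ≤ δ * (circuitScale R₀ (j g) - 1) := by
      have h1 : δ * circuitScale R₀ (j g) ≥ r := by rw [← hδR₀]; exact mul_le_mul_of_nonneg_left (hRj g) hδ.le
      nlinarith
    linarith
  · -- separation: order the two scales
    have hjne : j g ≠ j g' := by
      intro h
      apply hgg'
      have h1 := hjlo g; have h2 := hjhi g; have h3 := hjlo g'; have h4 := hjhi g'
      rw [h] at h1 h2
      apply Fin.ext
      rcases Nat.lt_or_ge (g : ℕ) g' with hlt | hge
      · exfalso
        have : ((g : ℕ) + 1) * m ≤ (g' : ℕ) * m := Nat.mul_le_mul_right m hlt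
        omega
      · rcases hge.lt_or_eq with hlt | heq
        · exfalso
          have : ((g' : ℕ) + 1) * m ≤ (g : ℕ) * m := Nat.mul_le_mul_right m hlt
          omega
        · exact heq.symm
    -- the key estimate for ordered scales
    have key : ∀ a b : Fin k, j a < j b → r / 2 ≤ hausdorffDist (γ a).range (γ b).range := by
      intro a b hab
      have hsc : 1024 * circuitScale R₀ (j a) ≤ circuitScale R₀ (j b) := mul_circuitScale_le (by linarith) hab
      have h := le_hausdorffDist_of_subset_ball_of_far (CurveClass.isCompact_range _) (CurveClass.range_nonempty _)
        (CurveClass.isCompact_range _) (CurveClass.range_nonempty _) (hγloc a) (hγfar b)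
      have h1 : δ * circuitScale R₀ (j a) ≥ r := by
        rw [← hδR₀]; exact mul_le_mul_of_nonneg_left (hRj a) hδ.le
      have h2 : r / 2 ≤ δ * (circuitScale R₀ (j b) - 1) / 2 - δ * (128 * circuitScale R₀ (j a) + 2) := by
        nlinarith [hRj1 a]
      linarith
    rcases lt_or_gt_of_ne hjne with hlt | hlt
    · exact key g g' hlt
    · rw [hausdorffDist_comm]; exact key g' g hlt

end ManyScales

/-! ### The limit: infinitely many non-trivial traces almost surely -/

section Limit

variable (D : JordanDomain)

/-- A Jordan domain contains a closed disc. [folklore] -/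
theorem _root_.Literature.Probability.RandomPlanarGeometry.JordanDomain.exists_closedBall_subset
    (D : JordanDomain) : ∃ (x₀ : ℂ) (r₀ : ℝ), 0 < r₀ ∧ closedBall x₀ r₀ ⊆ D.carrier := by
  obtain ⟨x₀, hx₀⟩ := D.isConnected.nonempty
  obtain ⟨ε, hε, hball⟩ := Metric.isOpen_iff.1 D.isOpen x₀ hx₀
  exact ⟨x₀, ε / 2, half_pos hε, closedBall_subset_ball (half_lt_self hε) |>.trans hball⟩

/-- `1 - ofReal (1 - t) ≤ ofReal t` in `ℝ≥0∞`. [folklore] -/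
theorem one_sub_ofReal_one_sub_le (t : ℝ) : 1 - ENNReal.ofReal (1 - t) ≤ ENNReal.ofReal t := by
  rw [tsub_le_iff_right]
  calc (1 : ℝ≥0∞) = ENNReal.ofReal ((1 - t) + t) := by simp
    _ ≤ ENNReal.ofReal (1 - t) + ENNReal.ofReal t := ENNReal.ofReal_add_le
    _ = ENNReal.ofReal t + ENNReal.ofReal (1 - t) := add_comm _ _

/-- **Uniform lower bound before the limit.** With `B̄(x₀, r₀) ⊆ D`, `c₀` the RSW constant of
`exists_pos_le_real_circuitAround`, and `r = r₀/(256·1024^{km})`: for every mesh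
`0 < δ ≤ r/250`, the loop collection has `k` `(r/2)`-separated traces with probability
`≥ 1 - k (1 - c₀³)^m` (`le_real_goodScales` around the lattice point nearest `x₀`).
[cite: CamiaNewman2006, Thm 2] -/
theorem le_measure_hasSeparatedTraces_triLoopCollection {x₀ : ℂ} {r₀ : ℝ} (hr₀ : 0 < r₀)
    (hball : closedBall x₀ r₀ ⊆ D.carrier) {c₀ : ℝ} (hc₀ : 0 ≤ c₀)
    (h : ∀ (c : Site 2) (R : ℝ), 1000 ≤ R →
      c₀ ≤ (triSitePercolation half).real (triOpenCircuitAround c R (2 * R)) ∧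
        c₀ ≤ (triSitePercolation half).real (triClosedCircuitAround c R (2 * R)))
    (k m : ℕ) {δ : ℝ} (hδ : 0 < δ) (hδr : δ ≤ r₀ / (256 * 1024 ^ (k * m)) / 250) :
    ENNReal.ofReal (1 - k * (1 - c₀ ^ 3) ^ m) ≤ triSitePercolation half
      {ω | LoopSpace.HasSeparatedTraces k (r₀ / (256 * 1024 ^ (k * m)) / 2) (triLoopCollection D δ ω)} := by
  obtain ⟨c, hc⟩ := exists_dist_triMeshPoint_le hδ x₀
  have hc' : dist x₀ (triMeshPoint δ c) ≤ δ := hc.trans (by linarith)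
  have hR₀ : 250 ≤ r₀ / (256 * 1024 ^ (k * m)) / δ := by
    rw [le_div_iff₀ hδ]
    have hpowN : (1 : ℝ) ≤ 1024 ^ (k * m) := one_le_pow₀ (by norm_num)
    have : 0 < r₀ / (256 * 1024 ^ (k * m)) := by positivity
    linarith
  have hsub : goodScales c (r₀ / (256 * 1024 ^ (k * m)) / δ) k m ⊆
      {ω | LoopSpace.HasSeparatedTraces k (r₀ / (256 * 1024 ^ (k * m)) / 2) (triLoopCollection D δ ω)} :=
    fun ω hω ↦ hasSeparatedTraces_triLoopCollection_of_goodScales D hr₀ hball k m hδ hδr hc' hω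
  calc ENNReal.ofReal (1 - k * (1 - c₀ ^ 3) ^ m)
      ≤ ENNReal.ofReal ((triSitePercolation half).real (goodScales c (r₀ / (256 * 1024 ^ (k * m)) / δ) k m)) :=
        ENNReal.ofReal_le_ofReal (le_real_goodScales h hc₀ c hR₀ k m)
    _ = triSitePercolation half (goodScales c (r₀ / (256 * 1024 ^ (k * m)) / δ) k m) :=
        ofReal_measureReal (measure_ne_top _ _)
    _ ≤ _ := measure_mono hsub

/-- **Every subsequential limit gives probability `≥ 1 - k(1 - c₀³)^m` to the closure of "`k`
`(r/2)`-separated traces"** (closed-set portmanteau for subsequential limits,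
`le_measure_of_isClosed_of_tendsto`, and the uniform bound
`le_measure_hasSeparatedTraces_triLoopCollection` for all small `δ`). [cite: CamiaNewman2006, Thm 2] -/
theorem le_measure_closure_hasSeparatedTraces_of_tendsto {l : Filter ℝ} [l.NeBot] (hl : l ≤ 𝓝[>] 0)
    {P' : ProbabilityMeasure (LoopSpace ℂ)} (hlim : Tendsto (triLoopLaw D) l (𝓝 P'))
    {x₀ : ℂ} {r₀ : ℝ} (hr₀ : 0 < r₀) (hball : closedBall x₀ r₀ ⊆ D.carrier) {c₀ : ℝ} (hc₀ : 0 ≤ c₀)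
    (h : ∀ (c : Site 2) (R : ℝ), 1000 ≤ R →
      c₀ ≤ (triSitePercolation half).real (triOpenCircuitAround c R (2 * R)) ∧
        c₀ ≤ (triSitePercolation half).real (triClosedCircuitAround c R (2 * R)))
    (k m : ℕ) :
    ENNReal.ofReal (1 - k * (1 - c₀ ^ 3) ^ m) ≤ (P' : Measure (LoopSpace ℂ))
      (closure {L | LoopSpace.HasSeparatedTraces k (r₀ / (256 * 1024 ^ (k * m)) / 2) L}) := by
  have hpowN : (1 : ℝ) ≤ 1024 ^ (k * m) := one_le_pow₀ (by norm_num)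
  have hr0 : 0 < r₀ / (256 * 1024 ^ (k * m)) := by positivity
  refine le_measure_of_isClosed_of_tendsto hl hlim isClosed_closure ?_
  filter_upwards [Ioc_mem_nhdsGT (show (0 : ℝ) < r₀ / (256 * 1024 ^ (k * m)) / 250 by positivity)] with δ hδ
  exact (le_measure_hasSeparatedTraces_triLoopCollection D hr₀ hball hc₀ h k m hδ.1 hδ.2).trans
    (measure_mono fun ω hω ↦ subset_closure hω)

/-- **Almost surely under every subsequential limit there are separated families of traces of
every size.** [cite: CamiaNewman2006, Thm 2] -/
theorem ae_exists_hasSeparatedTraces_of_tendsto {l : Filter ℝ} [l.NeBot] (hl : l ≤ 𝓝[>] 0)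
    {P' : ProbabilityMeasure (LoopSpace ℂ)} (hlim : Tendsto (triLoopLaw D) l (𝓝 P')) (k : ℕ) :
    ∀ᵐ L ∂(P' : Measure (LoopSpace ℂ)), ∃ ε : ℝ, 0 < ε ∧ LoopSpace.HasSeparatedTraces k ε L := by
  obtain ⟨x₀, r₀, hr₀, hball⟩ := D.exists_closedBall_subset
  obtain ⟨c₀, hc₀pos, h⟩ := exists_pos_le_real_circuitAround
  have hc₀le : c₀ ≤ 1 := by
    have := (h 0 1000 le_rfl).1
    exact this.trans ((measureReal_mono (subset_univ _) (measure_ne_top _ _)).trans_eq probReal_univ)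
  set q : ℝ := 1 - c₀ ^ 3 with hq
  have hq0 : 0 ≤ q := by rw [hq]; nlinarith [pow_le_one₀ hc₀pos.le hc₀le (n := 3)]
  have hq1 : q < 1 := by rw [hq]; nlinarith [pow_pos hc₀pos 3]
  -- the exceptional set has measure `≤ k q^m` for every `m`
  have hbound : ∀ m : ℕ, (P' : Measure (LoopSpace ℂ)) {L | ¬ ∃ ε : ℝ, 0 < ε ∧ LoopSpace.HasSeparatedTraces k ε L} ≤
      ENNReal.ofReal (k * q ^ m) := by
    intro m
    set r : ℝ := r₀ / (256 * 1024 ^ (k * m)) with hr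
    have hpowN : (1 : ℝ) ≤ 1024 ^ (k * m) := one_le_pow₀ (by norm_num)
    have hr0 : 0 < r := by positivity
    set F : Set (LoopSpace ℂ) := closure {L | LoopSpace.HasSeparatedTraces k (r / 2) L} with hF
    have hFle := le_measure_closure_hasSeparatedTraces_of_tendsto D hl hlim hr₀ hball hc₀pos.le h k m
    have hFsub : F ⊆ {L | ∃ ε : ℝ, 0 < ε ∧ LoopSpace.HasSeparatedTraces k ε L} := fun L hL ↦
      ⟨r / 2 / 2, by positivity, LoopSpace.closure_setOf_hasSeparatedTraces_subset (half_pos hr0) hL⟩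
    have hEsub : {L | ¬ ∃ ε : ℝ, 0 < ε ∧ LoopSpace.HasSeparatedTraces k ε L} ⊆ Fᶜ :=
      fun L hL hLF ↦ hL (hFsub hLF)
    calc (P' : Measure (LoopSpace ℂ)) {L | ¬ ∃ ε : ℝ, 0 < ε ∧ LoopSpace.HasSeparatedTraces k ε L}
        ≤ (P' : Measure (LoopSpace ℂ)) Fᶜ := measure_mono hEsub
      _ = 1 - (P' : Measure (LoopSpace ℂ)) F := prob_compl_eq_one_sub isClosed_closure.measurableSet
      _ ≤ 1 - ENNReal.ofReal (1 - k * q ^ m) := tsub_le_tsub_left hFle 1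
      _ ≤ ENNReal.ofReal (k * q ^ m) := one_sub_ofReal_one_sub_le _
  have h0 : (P' : Measure (LoopSpace ℂ)) {L | ¬ ∃ ε : ℝ, 0 < ε ∧ LoopSpace.HasSeparatedTraces k ε L} = 0 := by
    refine le_antisymm ?_ bot_le
    have ht : Tendsto (fun m : ℕ ↦ ENNReal.ofReal (k * q ^ m)) atTop (𝓝 0) := by
      rw [show (0 : ℝ≥0∞) = ENNReal.ofReal (k * 0) by simp]
      exact ENNReal.tendsto_ofReal ((tendsto_pow_atTop_nhds_zero_of_lt_one hq0 hq1).const_mul _)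
    exact le_of_tendsto_of_tendsto' tendsto_const_nhds ht hbound
  rw [ae_iff]
  exact h0

/-- **Scaling limits of the loop collections have infinitely many non-trivial loops** (the field
`IsCNLFamily.ae_infinite_traces` for any subsequential limit law; Camia–Newman, CMP 268 (2006),
Thm 2 (ii)): if the laws `triLoopLaw D δ` converge to `P'` along a non-trivial filter finer than
`𝓝[>] 0`, then `P'`-almost every collection has infinitely many distinct traces of non-trivial
members (`ae_exists_hasSeparatedTraces_of_tendsto` for every `k`, and
`LoopSpace.infinite_traces_of_forall_hasSeparatedTraces`). [cite: CamiaNewman2006, Thm 2] -/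
theorem ae_infinite_traces_of_tendsto {l : Filter ℝ} [l.NeBot] (hl : l ≤ 𝓝[>] 0)
    {P' : ProbabilityMeasure (LoopSpace ℂ)} (hlim : Tendsto (triLoopLaw D) l (𝓝 P')) :
    ∀ᵐ L ∂(P' : Measure (LoopSpace ℂ)),
      {s : Set ℂ | ∃ c ∈ L, ¬ CurveClass.IsTrivial c ∧ CurveClass.range c = s}.Infinite := by
  have hall : ∀ᵐ L ∂(P' : Measure (LoopSpace ℂ)), ∀ k : ℕ, ∃ ε : ℝ, 0 < ε ∧ LoopSpace.HasSeparatedTraces k ε L :=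
    ae_all_iff.2 fun k ↦ ae_exists_hasSeparatedTraces_of_tendsto D hl hlim k
  filter_upwards [hall] with L hL
  exact LoopSpace.infinite_traces_of_forall_hasSeparatedTraces hL

/-- The same for a cluster point of the laws along `𝓝[>] 0` (every subsequential limit law).
[cite: CamiaNewman2006, Thm 2] -/
theorem ae_infinite_traces_of_mapClusterPt {P' : ProbabilityMeasure (LoopSpace ℂ)}
    (h : MapClusterPt P' (𝓝[>] (0 : ℝ)) (triLoopLaw D)) :
    ∀ᵐ L ∂(P' : Measure (LoopSpace ℂ)),
      {s : Set ℂ | ∃ c ∈ L, ¬ CurveClass.IsTrivial c ∧ CurveClass.range c = s}.Infinite := by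
  obtain ⟨l, hne, hl, ht⟩ := h.exists_tendsto_of_le
  haveI := hne
  exact ae_infinite_traces_of_tendsto D hl ht

/-- **`TendstoLaw` form**: every law that is a limit in law of the loop collections (as in
`exists_isCNLFamily_tendsto`) has almost surely infinitely many distinct non-trivial traces
(Camia–Newman, CMP 268 (2006), Thm 2 (ii)). [cite: CamiaNewman2006, Thm 2] -/
theorem ae_infinite_traces_of_tendstoLaw {P' : Measure (LoopSpace ℂ)} [IsProbabilityMeasure P']
    (h : TendstoLaw (Ωδ := fun _ ↦ SiteConfig (Site 2)) (fun δ ↦ triLoopCollection D δ)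
      (fun _ ↦ triSitePercolation half) id P') :
    ∀ᵐ L ∂P', {s : Set ℂ | ∃ c ∈ L, ¬ CurveClass.IsTrivial c ∧ CurveClass.range c = s}.Infinite := by
  have h' := (tendstoLaw_iff_tendsto_triLoopLaw D).1 h
  exact ae_infinite_traces_of_tendsto D le_rfl h'

/-- **Reduction of `exists_isCNLFamily_tendsto`, reroot-saturation and infinitude of traces
discharged.** To prove the unrooted full-scaling-limit statement of `CLE6.lean` it suffices to
exhibit probability laws `ν D` that are limits in law of the loop collections in every Jordan
domain and to verify local finiteness of traces and conformal invariance: the loop property,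
membership of traces in `D̄` (`CLE6Limit.lean`), reroot-saturation (`CLE6RerootSaturated.lean`)
and infinitude of non-trivial traces (`ae_infinite_traces_of_tendstoLaw`) hold for every limit law
(Camia–Newman, MSRI 55 (2008), Thms 2–3; CMP 268 (2006), Thm 2). [cite: CamiaNewman2008, Theorems 2–3] -/
theorem exists_isCNLFamily_tendsto_of_tendstoLaw'' (ν : JordanDomain → Measure (LoopSpace ℂ))
    (hP : ∀ D, IsProbabilityMeasure (ν D))
    (hlim : ∀ D : JordanDomain, TendstoLaw (Ωδ := fun _ ↦ SiteConfig (Site 2))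
      (fun δ ↦ triLoopCollection D δ) (fun _ ↦ triSitePercolation half) id (ν D))
    (hfin : ∀ D, ∀ᵐ L ∂(ν D), ∀ ε : ℝ, 0 < ε →
      {s : Set ℂ | ∃ c ∈ L, CurveClass.range c = s ∧ ε < Metric.diam s}.Finite)
    (hconf : ∀ (D D' : JordanDomain) (φ : ConformalEquiv D.carrier D'.carrier) (Φ : C(ℂ, ℂ)),
      EqOn Φ φ D.carrier → MapsTo Φ (closure D.carrier) (closure D'.carrier) →
        ν D' = (ν D).map (LoopSpace.map Φ)) :
    exists_isCNLFamily_tendsto :=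
  exists_isCNLFamily_tendsto_of_tendstoLaw' ν hP hlim hfin
    (fun D ↦ by haveI := hP D; exact ae_infinite_traces_of_tendstoLaw D (hlim D)) hconf

end Limit

end Literature.Probability.Percolation
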